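import Summits.AtomisticToContinuum.FouriersLaw.Theorems.OddSectorIrreversibilityCorrectorTheoryUniformMixing
import HarnessLib

/-!
# `stub_uniformMixing` of line `loomis-compact-horizon-witness`: δ-uniform CEHR (2.5) mixing
(crux `EmbeddedDrudeMourre.AbelThermodynamicLimit`, item stmt-AtomisticToContinuum-12596;
`--supports` file proving the registered leaf `stub_uniformMixing` of S3 `stub_anchoredKubo`, closes nothing)

The registered leaf asks, for the pinned chain `P = pinnedChain ω₂ lam β γ` (all parameters `> 0`),
`T > 0` and `N ≥ 2`, for the exponential convergence (2.5) of Cuneo–Eckmann–Hairer–Rey-Bellet 2018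
(Thm 2.13 (3)) of the transition semigroups `P^δ_t = transitionKernel N (T+δ/2) (T-δ/2) t` to each of
their invariant probability measures, in the weighted norm `|f| ≤ e^{ϑH}`, with ONE width `δ₀ ∈ (0, 2T)`,
ONE exponent `ϑ ∈ (0, 1/(T+δ₀/2))` and ONE pair of constants `(C_m, c)` for all `|δ| < δ₀`.

This is exactly the uniform-in-`δ` Harris theorem already proved in the tree for the route
`OddSectorIrreversibility` (item stmt-14071): `Corrector.pinnedChain_uniformMixing`
(`…OddSectorIrreversibilityCorrectorTheoryUniformMixing.lean`; uniform drift `pinnedChain_drift_uniform`,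
uniform local minorisation `pinnedChain_minorization_at_one_uniform`, uniform reachability
`pinnedChain_reach_uniform`, uniform Harris theorem `pinnedChain_uniformMixing_of_uniformDriftMinor`),
stated there for `lam ≥ 0`, `N ≥ 1` and with the extra conjunct `2ϑ < 1/T`. The present file only
specialises it to the registered signature (`lam > 0`, `N ≥ 2`, extra conjunct dropped). With it the landed
`stub_anchoredKuboOfUniformMixing` (p93721) yields S3 `stub_anchoredKubo` by name.

References: Cuneo–Eckmann–Hairer–Rey-Bellet 2018, Thm 2.13 (3) / eq. (2.5); Hairer–Mattingly 2011, Thm 1.2.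
No definitions, no named facts.
-/

noncomputable section

open MeasureTheory ProbabilityTheory Filter Topology Set
open scoped NNReal ENNReal

namespace Summit.AtomisticToContinuum.FouriersLaw.Theorems.AbelThermodynamicLimit.LoomisCompactHorizonWitness

open Literature.MathematicalPhysics.KineticTheory.HeatConduction
open Literature.MathematicalPhysics.KineticTheory OscillatorChain
open Summit.AtomisticToContinuum.FouriersLaw.Theorems.OddSectorIrreversibility.Corrector

/-- **Registered leaf `stub_uniformMixing` — δ-UNIFORM EXPONENTIAL MIXING of the two-temperature
semigroups near equilibrium.** For `P = pinnedChain ω₂ lam β γ` (all `> 0`), `T > 0`, `N ≥ 2` there are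
`δ₀ ∈ (0, 2T)`, a weight exponent `ϑ ∈ (0, 1/(T+δ₀/2))` and constants `C_m ≥ 0`, `c > 0` such that for
every `|δ| < δ₀`, every invariant probability measure `ν` of the kernels
`transitionKernel N (T+δ/2) (T-δ/2)`, every `z`, `t ≥ 0` and every continuous `f` with `|f| ≤ e^{ϑH}`:
`|P^δ_t f(z) - ν(f)| ≤ C_m e^{ϑH(z)} e^{-ct}` — Cuneo–Eckmann–Hairer–Rey-Bellet 2018 eq. (2.5) with the
Harris constants tracked uniformly over the compact set of bath-temperature pairs; a specialisation of
the tree's `Corrector.pinnedChain_uniformMixing`.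
[cite: CuneoEckmannHairerReyBellet2018, Thm 2.13 (3)] [cite: HairerMattingly2011, Thm 1.2] -/
theorem stub_uniformMixing :
    ∀ ω₂ lam β γ : ℝ, 0 < ω₂ → 0 < lam → 0 < β → 0 < γ → ∀ T : ℝ, 0 < T →
      ∀ (N : ℕ), 2 ≤ N →
          ∃ δ₀ ϑ Cm c : ℝ, 0 < δ₀ ∧ δ₀ < 2 * T ∧ 0 < ϑ ∧ ϑ < 1 / (T + δ₀ / 2) ∧ 0 ≤ Cm ∧ 0 < c ∧
            ∀ δ : ℝ, |δ| < δ₀ → ∀ ν : MeasureTheory.Measure (Literature.MathematicalPhysics.KineticTheory.HeatConduction.PhaseSpace N),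
              MeasureTheory.IsProbabilityMeasure ν →
              (∀ t : NNReal, ν.bind ((Literature.MathematicalPhysics.KineticTheory.HeatConduction.pinnedChain ω₂ lam β γ).transitionKernel N (T + δ / 2) (T - δ / 2) t) = ν) →
              ∀ (z : Literature.MathematicalPhysics.KineticTheory.HeatConduction.PhaseSpace N) (t : NNReal) (f : Literature.MathematicalPhysics.KineticTheory.HeatConduction.PhaseSpace N → ℝ), Continuous f →
                (∀ y, |f y| ≤ Real.exp (ϑ * (Literature.MathematicalPhysics.KineticTheory.HeatConduction.pinnedChain ω₂ lam β γ).hamiltonian N y)) →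
                |(∫ y, f y ∂((Literature.MathematicalPhysics.KineticTheory.HeatConduction.pinnedChain ω₂ lam β γ).transitionKernel N (T + δ / 2) (T - δ / 2) t z)) -
                    ∫ y, f y ∂ν| ≤
                  Cm * Real.exp (ϑ * (Literature.MathematicalPhysics.KineticTheory.HeatConduction.pinnedChain ω₂ lam β γ).hamiltonian N z) * Real.exp (-c * t) := by
  intro ω₂ lam β γ hω hl hβ hγ T hT N hN
  obtain ⟨δ₀, ϑ, Cm, c, hδ₀, hδ₀T, hϑ0, hϑT, -, hCm, hc, hUM⟩ :=
    pinnedChain_uniformMixing (N := N) hω hl.le hβ hγ (by omega) hT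
  exact ⟨δ₀, ϑ, Cm, c, hδ₀, hδ₀T, hϑ0, hϑT, hCm, hc, hUM⟩

end Summit.AtomisticToContinuum.FouriersLaw.Theorems.AbelThermodynamicLimit.LoomisCompactHorizonWitness

end
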